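import Summits.HubbardSuperconductivity.HubbardSuperconductivity.Theses.ChiralWindow

/-!
# Route `ChiralWindow` — glue item `CwGlue` (stmt-HubbardSuperconductivity-1743)

`CwChiralConstruction → CwSsbToEvenTorusLRO → CwThesis`: pure logic.  Take
`U₀ := min U₀ᶜ U₀ᵗ` (the construction threshold and the transfer threshold); for `U ∈ (0, U₀)` the
construction gives `δ ∈ [3/10, 12/25]`, a chemical potential `μ`, the density limit `1 - δ` and
`exp (-C/U²) ≤ dWaveOrderParameter U μ`, whence `HasDWaveOrder U μ` because `0 < exp (-C/U²)`;
since `[3/10, 12/25] ⊂ (0, 1/2)` the transfer applies at `(U, δ, μ)` and yields the summit's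
matrix at `(U, δ)`, i.e. the body of `CwThesis`.
-/

namespace Summit.HubbardSuperconductivity.HubbardSuperconductivity.Theorems

open Literature.MathematicalPhysics.QuantumLattice
open Summit.HubbardSuperconductivity.HubbardSuperconductivity.Theses.ChiralWindow

/-- **`CwGlue`** (stmt-HubbardSuperconductivity-1743): the chiral construction
(`CwChiralConstruction`) and the SSB-to-even-torus-LRO transfer (`CwSsbToEvenTorusLRO`) give the
route thesis `CwThesis`, with `U₀ := min` of the two thresholds; `0 < exp (-C/U²)` gives
`HasDWaveOrder U μ`, and `[3/10, 12/25] ⊂ (0, 1/2)`. Pure logic. -/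
theorem cwGlue_proof :
    Summit.HubbardSuperconductivity.HubbardSuperconductivity.Theses.ChiralWindow.CwGlue := by
  unfold CwGlue
  rintro ⟨U₀, hU₀, C, -, hcon⟩ ⟨U₁, hU₁, htr⟩
  refine ⟨min U₀ U₁, lt_min hU₀ hU₁, ?_⟩
  rintro U ⟨hU0, hUlt⟩
  obtain ⟨δ, hδ, μ, hdens, hexp⟩ := hcon U ⟨hU0, hUlt.trans_le (min_le_left _ _)⟩
  refine ⟨δ, hδ, ?_⟩
  have hδ' : δ ∈ Set.Ioo (0 : ℝ) (1 / 2) := ⟨by linarith [hδ.1], by linarith [hδ.2]⟩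
  have hord : HasDWaveOrder U μ := lt_of_lt_of_le (Real.exp_pos _) hexp
  exact htr U ⟨hU0, hUlt.trans_le (min_le_right _ _)⟩ δ hδ' μ hdens hord

end Summit.HubbardSuperconductivity.HubbardSuperconductivity.Theorems
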